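import Summits.MatrixMultiplication.MatrixMultiplication.Theses.ReesMunnRealization
import Summits.MatrixMultiplication.MatrixMultiplication.Theorems.ReesMunnRealizationReesHostBlocks
import Summits.MatrixMultiplication.MatrixMultiplication.Theorems.ReesMunnRealizationRealizationRestricts
import Summits.MatrixMultiplication.MatrixMultiplication.Theorems.CongruenceTowerPackingDegreeLeIndexAbelian
import Literature.RepresentationTheory.FiniteGroups.WedderburnBlocks

/-!
# `BlockRestrictionFamily` — typed decomposition (crux-strategist split, D-0019 / D-0027 A7)

Route `MatrixMultiplication/ReesMunnRealization`, deciding crux `stmt-MatrixMultiplication-4368`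
(`BlockRestrictionFamily`, the target X: constant-loss ONE-SHOT block restrictions
`⟨a,b,e⟩ ≤ ⊕ᵢ ⟨dᵢ,dᵢ,dᵢ⟩` with arbitrarily many comparable blocks).

X is decomposed along the route's own mechanism into two pieces of different type, and the glue
uses three closed items / tree theorems:

* **`FibreDesignFamily`** (crux — DESIGN THEORY, the whole difficulty, in the sharp FIBRE form to
  which the route's refuters reduced every Rees design): there is `c > 0` such that for every `t`
  some finite group `G` with an ABELIAN SUBGROUP `A` of small index, `t·[G:A]² ≤ |G|`, some
  `n ≥ 1`, a sandwich matrix `P : [n]×[n] → G ∪ {0}` and a strict realization `(φ,ψ,χ)` of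
  `⟨a,b,e⟩` in the `P`-twisted FIBRE tensor `F_P((λ,g),(ι,h)) = g·P[λ,ι]·h ∈ G ∪ {0}` have
  `c·n·|G|^{3/2} ≤ abe` (flattenings of `F_P` give `abe ≤ n|G|^{3/2}`, so this is constant loss;
  the route's crux `FibrePacking` is exactly the statement `abe ≤ n|G|` for abelian `G`).
* **`FibreLift`** (support, provable now — proved below as `fibreLift_proof`): a strict fibre
  realization of `⟨a,b,e⟩` in `F_P` lifts ("copy it into every (row-label, column-label) fibre")
  to a strict realization of `⟨n·a, b, n·e⟩` in the Rees matrix semigroup `M⁰(G;n,n;P)`.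
* glue (this file, `blockRestrictionFamily_of_subs`, sorry-free): lift; Wedderburn blocks
  `ℂ[G] ≃ₐ ∏ᵢ ℂ^{dᵢ×dᵢ}` (`exists_algEquiv_pi_matrix`); blocks `n·dᵢ`;
  `⊕ᵢ ⟨n dᵢ⟩ ≥ R_P ≥ ⟨na, b, ne⟩` by the closed items `ReesHostBlocks` (`reesHostBlocks_proof`) and
  `RealizationRestricts` (`RealizationRestricts_proof`, Cohn–Umans 2013 Prop. 9);
  `∑ (n dᵢ)² = n²|G|` (`sum_sq_blockDegrees_eq_card`); every block size is a character degree
  (`blockDegree_mem_charDegrees`) hence `dᵢ ≤ [G:A]` by the closed item `DegreeLeIndexAbelian` of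
  route `CongruenceTowerPacking` (`DegreeLeIndexAbelian_proof`, Isaacs Problem 2.9(b)); so
  `t (n dᵢ)² ≤ n²·t[G:A]² ≤ n²|G|` (comparability); packing `c (|G| n²)^{3/2} = n²·c·n|G|^{3/2} ≤
  n² abe = (na) b (ne)`; and `(na) b (ne) ≥ 1`.

References: Cohn–Umans 2003 (§1.3, Lemma 3.1, Thm. 4.1); Cohn–Kleinberg–Szegedy–Umans 2005 (§1.1);
Cohn–Umans 2013, arXiv:1207.6528 (Def. 8, Prop. 9–10); Isaacs 1976 (Problem 2.9(b));
Blasiak–Cohn–Grochow–Pratt–Umans 2023 (Thm. 3.2, Rem. 3.7); Clifford–Preston Vol. I §3 /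
Steinberg 2016 Ch. 5 (Rees matrix semigroups, Munn algebras).
-/

-- single-conjunct summit: the mandated namespace repeats `MatrixMultiplication`.
set_option linter.dupNamespace false

noncomputable section

open scoped BigOperators

namespace Summit.MatrixMultiplication.MatrixMultiplication.Theorems

open Literature.Computability.AlgebraicComplexity
open Literature.RepresentationTheory.FiniteGroups

/-- **Fibre lift** (piece `FibreLift`, support): a strict realization `(φ, ψ, χ)` of `⟨a,b,e⟩` in
the `P`-twisted fibre tensor `F_P` over `G` yields a strict realization of `⟨n·a, b, n·e⟩` in the
Rees matrix semigroup `M⁰(G; n, n; P)`: index `[n·a] = [n] × [a]` by (row label `ρ`, `i`) and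
`[n·e] = [n] × [e]` by (column label `γ`, `k`), and put `φ'((ρ,i),j) = (ρ, g_{ij}, λ_{ij})`,
`ψ'(j,(γ,k)) = (ι_{jk}, h_{jk}, γ)`, `χ'((ρ,i),(γ,k)) = (ρ, χ_{ik}, γ)`; the Rees product
`(ρ, g P[λ,ι] h, γ)` reproduces the fibre condition in every fibre, and different fibres are
separated by their labels. [folklore] -/
theorem fibreLift_proof :
    ∀ (G : Type) [Group G] (n a b e : ℕ) (P : Fin n → Fin n → Option G) (φ : Fin a × Fin b → Fin n × G) (ψ : Fin b × Fin e → Fin n × G) (χ : Fin a × Fin e → G), (∀ x y z, ((P (φ x).1 (ψ y).1).map (fun p => (φ x).2 * p * (ψ y).2) = some (χ z) ↔ (z.1 = x.1 ∧ x.2 = y.1 ∧ z.2 = y.2))) → ∃ (φ' : Fin (n * a) × Fin b → Fin n × G × Fin n) (ψ' : Fin b × Fin (n * e) → Fin n × G × Fin n) (χ' : Fin (n * a) × Fin (n * e) → Fin n × G × Fin n), ∀ x y z, ((P (φ' x).2.2 (ψ' y).1).map (fun p => ((φ' x).1, (φ' x).2.1 * p * (ψ' y).2.1, (ψ' y).2.2))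 = some (χ' z) ↔ (z.1 = x.1 ∧ x.2 = y.1 ∧ z.2 = y.2)) := by
  intro G _ n a b e P φ ψ χ hfib
  refine ⟨fun x => ((finProdFinEquiv.symm x.1).1, (φ ((finProdFinEquiv.symm x.1).2, x.2)).2,
      (φ ((finProdFinEquiv.symm x.1).2, x.2)).1),
    fun y => ((ψ (y.1, (finProdFinEquiv.symm y.2).2)).1, (ψ (y.1, (finProdFinEquiv.symm y.2).2)).2,
      (finProdFinEquiv.symm y.2).1),
    fun z => ((finProdFinEquiv.symm z.1).1,
      χ ((finProdFinEquiv.symm z.1).2, (finProdFinEquiv.symm z.2).2), (finProdFinEquiv.symm z.2).1),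
    ?_⟩
  rintro ⟨x1, j⟩ ⟨j', y2⟩ ⟨z1, z2⟩
  obtain ⟨⟨ρ, i⟩, rfl⟩ := finProdFinEquiv.surjective x1
  obtain ⟨⟨γ, k⟩, rfl⟩ := finProdFinEquiv.surjective y2
  obtain ⟨⟨ρz, iz⟩, rfl⟩ := finProdFinEquiv.surjective z1
  obtain ⟨⟨γz, kz⟩, rfl⟩ := finProdFinEquiv.surjective z2
  have h := hfib (i, j) (j', k) (iz, kz)
  simp only [Equiv.symm_apply_apply, EmbeddingLike.apply_eq_iff_eq, Prod.mk.injEq] at h ⊢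
  cases hP : P (φ (i, j)).1 (ψ (j', k)).1 with
  | none =>
    rw [hP] at h
    simp only [Option.map_none, reduceCtorEq, false_iff] at h ⊢
    exact fun hh => h ⟨hh.1.2, hh.2.1, hh.2.2.2⟩
  | some p =>
    rw [hP] at h
    simp only [Option.map_some, Option.some.injEq, Prod.mk.injEq] at h ⊢
    constructor
    · rintro ⟨h1, h2, h3⟩
      obtain ⟨h4, h5, h6⟩ := h.mp h2
      exact ⟨⟨h1.symm, h4⟩, h5, h3.symm, h6⟩
    · rintro ⟨⟨h1, h4⟩, h5, h3, h6⟩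
      exact ⟨h1.symm, h.mpr ⟨h4, h5, h6⟩, h3.symm⟩

/-- **`BlockRestrictionFamily` from a fibre design family and the fibre lift** (typed split of the
deciding crux `stmt-MatrixMultiplication-4368` of route `ReesMunnRealization`):
`FibreDesignFamily → FibreLift → BlockRestrictionFamily`, the two hypotheses stated inline (they
are the route's child items `FibreDesignFamily` (crux) and `FibreLift` (support)). Blocks `n·dᵢ`
over the Wedderburn decomposition of `ℂ[G]`; restriction chain `⊕ᵢ ⟨n dᵢ⟩ ≥ R_P ≥ ⟨na,b,ne⟩`
(`reesHostBlocks_proof`, `RealizationRestricts_proof`); `∑ (n dᵢ)² = n²|G|`; comparability from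
`dᵢ ∈ charDegrees G`, `dᵢ ≤ [G:A]` (`DegreeLeIndexAbelian_proof`), `t[G:A]² ≤ |G|`; packing
`c(|G|n²)^{3/2} = n²·(c·n|G|^{3/2}) ≤ n²·abe`. [folklore] -/
theorem blockRestrictionFamily_of_subs
    (hdes : ∃ c : ℝ, 0 < c ∧ ∀ t : ℕ, ∃ (G : Type) (_ : Group G) (_ : Fintype G) (A : Subgroup G) (n a b e : ℕ) (P : Fin n → Fin n → Option G) (φ : Fin a × Fin b → Fin n × G) (ψ : Fin b × Fin e → Fin n × G) (χ : Fin a × Fin e → G), (∀ x ∈ A, ∀ y ∈ A, x * y = y * x) ∧ 1 ≤ n ∧ t * A.index ^ 2 ≤ Fintype.card G ∧ (∀ x y z, ((P (φ x).1 (ψ y).1).map (fun p => (φ x).2 * p * (ψ y).2) = some (χ z) ↔ (z.1 = x.1 ∧ x.2 = y.1 ∧ z.2 = y.2))) ∧ c * ((n : ℝ) * (Fintype.card G : ℝ) ^ ((3 : ℝ) / 2)) ≤ ((a * b * e : ℕ) : ℝ))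
    (hlift : ∀ (G : Type) [Group G] (n a b e : ℕ) (P : Fin n → Fin n → Option G) (φ : Fin a × Fin b → Fin n × G) (ψ : Fin b × Fin e → Fin n × G) (χ : Fin a × Fin e → G), (∀ x y z, ((P (φ x).1 (ψ y).1).map (fun p => (φ x).2 * p * (ψ y).2) = some (χ z) ↔ (z.1 = x.1 ∧ x.2 = y.1 ∧ z.2 = y.2))) → ∃ (φ' : Fin (n * a) × Fin b → Fin n × G × Fin n) (ψ' : Fin b × Fin (n * e) → Fin n × G × Fin n) (χ' : Fin (n * a) × Fin (n * e) → Fin n × G × Fin n), ∀ x y z, ((P (φ' x).2.2 (ψ' y).1).map (fun p => ((φ' x).1, (φ' x).2.1 * p * (ψ' y).2.1, (ψ' y).2.2)) = some (χ' z) ↔ (z.1 = x.1 ∧ x.2 = y.1 ∧ z.2 = y.2))) :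
    Summit.MatrixMultiplication.MatrixMultiplication.Theses.ReesMunnRealization.BlockRestrictionFamily := by
  obtain ⟨c, hc, hfam⟩ := hdes
  refine ⟨c, hc, fun t => ?_⟩
  obtain ⟨G, _instG, _instF, A, n, a, b, e, P, φ, ψ, χ, hA, hn, ht, hfib, hpack⟩ := hfam t
  classical
  -- lift the fibre design to a strict realization of `⟨na, b, ne⟩` in `M⁰(G;n,n;P)`
  obtain ⟨φ', ψ', χ', hreal⟩ := hlift G n a b e P φ ψ χ hfib
  -- Wedderburn blocks `ℂ[G] ≃ₐ ∏ᵢ ℂ^{dᵢ×dᵢ}`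
  obtain ⟨r, d, hd, ⟨iso⟩⟩ := exists_algEquiv_pi_matrix G
  haveI : ∀ i, NeZero (d i) := hd
  have hsum : ∑ i, d i ^ 2 = Nat.card G := sum_sq_blockDegrees_eq_card iso
  -- there is at least one block
  have hr : 0 < r := by
    rcases Nat.eq_zero_or_pos r with h0 | h0
    · subst h0
      rw [Fin.sum_univ_zero] at hsum
      exact absurd hsum.symm Nat.card_pos.ne'
    · exact h0
  -- `∑ᵢ (n dᵢ)² = |G| · n²` over `ℝ`
  have hsumR : ∑ i, (((n * d i : ℕ) : ℝ)) ^ 2 = (Fintype.card G : ℝ) * (n : ℝ) ^ 2 := by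
    have h1 : ((∑ i, d i ^ 2 : ℕ) : ℝ) = (Fintype.card G : ℝ) := by
      rw [hsum, Nat.card_eq_fintype_card]
    push_cast at h1
    rw [← h1, Finset.sum_mul]
    exact Finset.sum_congr rfl fun i _ => by push_cast; ring
  -- the host tensor `R_P` restricts from `⊕ᵢ ⟨n dᵢ⟩` (closed item `ReesHostBlocks`)
  have hhost := reesHostBlocks_proof G n P r d hd iso
  -- `R_P ≥ ⟨na, b, ne⟩` (closed item `RealizationRestricts`, Cohn–Umans 2013 Prop. 9)
  have hreal' := RealizationRestricts_proof (Fin n × G × Fin n) (Fin n × G × Fin n)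
    (Fin n × G × Fin n)
    (fun x y => (P x.2.2 y.1).map (fun p => (x.1, x.2.1 * p * y.2.1, y.2.2))) (n * a) b (n * e)
    φ' ψ' χ' hreal
  -- positivity bookkeeping
  have hGpos : (0 : ℝ) < (Fintype.card G : ℝ) := Nat.cast_pos.mpr Fintype.card_pos
  have hnpos : (0 : ℝ) < (n : ℝ) := Nat.cast_pos.mpr hn
  have hpos : (0 : ℝ) < c * ((n : ℝ) * (Fintype.card G : ℝ) ^ ((3 : ℝ) / 2)) :=
    mul_pos hc (mul_pos hnpos (Real.rpow_pos_of_pos hGpos _))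
  have habe : 0 < a * b * e := Nat.cast_pos.mp (hpos.trans_le hpack)
  have ha : 0 < a := Nat.pos_of_ne_zero fun h => by simp [h] at habe
  have hb : 0 < b := Nat.pos_of_ne_zero fun h => by simp [h] at habe
  have he : 0 < e := Nat.pos_of_ne_zero fun h => by simp [h] at habe
  refine ⟨r, fun i => n * d i, n * a, b, n * e, hr, fun i => ?_, ?_, hhost.trans hreal', ?_, ?_⟩
  · -- every block is non-empty: `1 ≤ n dᵢ`
    exact Nat.succ_le_of_lt (Nat.mul_pos hn (Nat.pos_of_ne_zero (NeZero.ne (d i))))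
  · -- `(na) b (ne) ≥ 1`
    exact Nat.succ_le_of_lt (Nat.mul_pos (Nat.mul_pos (Nat.mul_pos hn ha) hb) (Nat.mul_pos hn he))
  · -- packing: `c (|G| n²)^{3/2} = n² · (c · n |G|^{3/2}) ≤ n² · abe = (na) b (ne)`
    simp only [hsumR]
    have hpow : ((Fintype.card G : ℝ) * (n : ℝ) ^ 2) ^ ((3 : ℝ) / 2) =
        (Fintype.card G : ℝ) ^ ((3 : ℝ) / 2) * (n : ℝ) ^ 3 := by
      rw [Real.mul_rpow hGpos.le (sq_nonneg _)]
      congr 1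
      rw [← Real.rpow_natCast _ 2, ← Real.rpow_mul hnpos.le, ← Real.rpow_natCast _ 3]
      norm_num
    calc c * ((Fintype.card G : ℝ) * (n : ℝ) ^ 2) ^ ((3 : ℝ) / 2)
        = (n : ℝ) ^ 2 * (c * ((n : ℝ) * (Fintype.card G : ℝ) ^ ((3 : ℝ) / 2))) := by
          rw [hpow]; ring
      _ ≤ (n : ℝ) ^ 2 * ((a * b * e : ℕ) : ℝ) := mul_le_mul_of_nonneg_left hpack (sq_nonneg _)
      _ = ((n * a * b * (n * e) : ℕ) : ℝ) := by push_cast; ring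
  · -- comparability: `t (n dᵢ)² ≤ n² · t [G:A]² ≤ n² |G| = ∑ⱼ (n dⱼ)²`
    intro i
    simp only [hsumR]
    have hdi : d i ≤ A.index :=
      DegreeLeIndexAbelian_proof G A hA (d i) (blockDegree_mem_charDegrees iso i)
    have hnat : t * d i ^ 2 ≤ Fintype.card G :=
      le_trans (Nat.mul_le_mul_left t (Nat.pow_le_pow_left hdi 2)) ht
    have hR : (t : ℝ) * (d i : ℝ) ^ 2 ≤ (Fintype.card G : ℝ) := by exact_mod_cast hnat
    calc (t : ℝ) * ((n * d i : ℕ) : ℝ) ^ 2 = ((t : ℝ) * (d i : ℝ) ^ 2) * (n : ℝ) ^ 2 := by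
          push_cast; ring
      _ ≤ (Fintype.card G : ℝ) * (n : ℝ) ^ 2 := mul_le_mul_of_nonneg_right hR (sq_nonneg _)

end Summit.MatrixMultiplication.MatrixMultiplication.Theorems

end
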